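import Summits.MatrixMultiplication.MatrixMultiplication.Theses.LevelGradedCohnUmans

/-!
# Crux-ideate sketches for `GradedDesignFamily` (stmt-MatrixMultiplication-7610), ideator 1, round 1

First lemmas of the three idea cards, stated over existing declarations. PROVED (axioms propext /
Classical.choice / Quot.sound): `family_of_single`, `subgroup_identity_separated`. The remaining
`sorry`s (`gradedWreathLink`, `triangleGradable_imp`, `colourLink`) are the content of the lines:

* card `graded-stpp-wreath`      — `SimSeparated`, `GradedSimultaneousFamily`, `gradedWreathLink`,
                                    `family_of_single` (t = 1 direction, PROVED: the transfer is an equivalence);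
* WITHDRAWN card `grade-the-champions` (thesis refuted this session: negative-champions-ungradable.md,
  sign-obstruction theorem + kit j013233/j013408) — kept as by-products: `subgroup_identity_separated`
  (general-`G` identity test ⇒ separation, PROVED, reusable by every subgroup line), `dimCutoff`,
  `TriPts`/`triYoung`/`TriangleGradable`/`triangleGradable_imp` (the triangle statement is now expected
  to be FALSE: at n = 3 every separating spectrum contains the 16-dimensional irreducible > V^{1/3} = 12);
* card `schur-weyl-colour-cells` — `colourSpace`, `ColourBudget`, `ColourDesigns`, `colourLink`,
                                    `ColourUniversality`.
-/

namespace Summit.MatrixMultiplication.MatrixMultiplication.Cruxes.GradedDesignFamily.Ideator1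

open Summit.MatrixMultiplication.MatrixMultiplication.Theses.LevelGradedCohnUmans
open Literature.RepresentationTheory.FiniteGroups

noncomputable section

/-! ## Common vocabulary (the clauses of `GradedDesignFamily`, named) -/

/-- `J`-separation of one triple: the separation clause of `GradedDesignFamily` verbatim. [folklore] -/
def Separated {G : Type} [Group G] (J : Set (G → ℂ)) (X Y Z : Finset G) : Prop :=
  ∀ x₀ ∈ X, ∀ z₀ ∈ Z, ∃ f ∈ J, ∀ x ∈ X, ∀ y ∈ Y, ∀ y' ∈ Y, ∀ z ∈ Z,
    (x = x₀ ∧ y = y' ∧ z = z₀ → f (x⁻¹ * y * y'⁻¹ * z) = 1) ∧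
    (¬ (x = x₀ ∧ y = y' ∧ z = z₀) → f (x⁻¹ * y * y'⁻¹ * z) = 0)

/-- Bi-invariance of a test space (the first clause of `GradedDesignFamily`). [folklore] -/
def BiInvariant {G : Type} [Group G] (J : Submodule ℂ (G → ℂ)) : Prop :=
  ∀ f ∈ J, ∀ a b : G, (fun g : G => f (a * g * b)) ∈ J

/-- The graded budget `Σ_{χ ∈ Irr G ∩ J} χ(1)^s` (the price of `GradedPricing`). [folklore] -/
def gradedBudget (G : Type) [Group G] [Fintype G] (J : Submodule ℂ (G → ℂ)) (s : ℝ) : ℝ :=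
  ∑ᶠ χ ∈ irrChars G ∩ (J : Set (G → ℂ)), (χ 1).re ^ s

/-- `GradedDesignFamily` restated through the vocabulary (sanity: definitional up to `Iff`). [folklore] -/
theorem gradedDesignFamily_iff :
    GradedDesignFamily ↔ ∀ ε : ℝ, 0 < ε → ∃ (G : Type) (_ : Group G) (_ : Fintype G)
      (J : Submodule ℂ (G → ℂ)) (X Y Z : Finset G), BiInvariant J ∧ Separated (J : Set (G → ℂ)) X Y Z ∧
      gradedBudget G J (2 + ε) < ((X.card * Y.card * Z.card : ℕ) : ℝ) ^ ((2 + ε) / 3) :=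
  Iff.rfl

/-! ## Card `graded-stpp-wreath`: simultaneity instead of saturation -/

/-- **Simultaneous `J`-separation** of a family `(X_i, Y_i, Z_i)_{i < t}` — the graded form of the
CKSU simultaneous triple product property: for each `i` and each target `(x₀, z₀) ∈ X_i × Z_i`
ONE test `f ∈ J` reads, on every mixed quadruple product `x⁻¹ y y'⁻¹ z` with `x ∈ X_a, y ∈ Y_a,
y' ∈ Y_b, z ∈ Z_b`, the value `[a = i ∧ b = i ∧ x = x₀ ∧ y = y' ∧ z = z₀]`.  With `t = 1` it is
`Separated`. [cite: CohnKleinbergSzegedyUmans2005, Def. 5.1] -/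
def SimSeparated {G : Type} [Group G] (J : Set (G → ℂ)) {t : ℕ} (X Y Z : Fin t → Finset G) : Prop :=
  ∀ i : Fin t, ∀ x₀ ∈ X i, ∀ z₀ ∈ Z i, ∃ f ∈ J, ∀ a b : Fin t,
    ∀ x ∈ X a, ∀ y ∈ Y a, ∀ y' ∈ Y b, ∀ z ∈ Z b,
      ((a = i ∧ b = i ∧ x = x₀ ∧ y = y' ∧ z = z₀) → f (x⁻¹ * y * y'⁻¹ * z) = 1) ∧
      (¬ (a = i ∧ b = i ∧ x = x₀ ∧ y = y' ∧ z = z₀) → f (x⁻¹ * y * y'⁻¹ * z) = 0)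

/-- **Graded STPP families** (the equivalent form `X⁺` of the crux): for every `ε > 0` a finite
group, a bi-invariant `J` and a simultaneously `J`-separated family whose TOTAL
`Σ_i (|X_i||Y_i||Z_i|)^{(2+ε)/3}` beats the graded budget `Σ_{χ ∈ Irr ∩ J} χ(1)^{2+ε}`. -/
def GradedSimultaneousFamily : Prop :=
  ∀ ε : ℝ, 0 < ε → ∃ (G : Type) (_ : Group G) (_ : Fintype G) (J : Submodule ℂ (G → ℂ)) (t : ℕ)
    (X Y Z : Fin t → Finset G), BiInvariant J ∧ SimSeparated (J : Set (G → ℂ)) X Y Z ∧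
      gradedBudget G J (2 + ε) <
        ∑ i : Fin t, (((X i).card * (Y i).card * (Z i).card : ℕ) : ℝ) ^ ((2 + ε) / 3)

/-- FIRST LEMMA of the card (graded Cohn–Kleinberg–Szegedy–Umans §7): a graded STPP family gives a
single graded design — in `Sym_M ⋉ (G^N)^M` with test space `J^{⊗NM} ⊗ ℂ^{Sym_M}`, separator
`[τ = τ₀]·⊗φ_j`, budget `≤ (M!)^{s-1}(Σ_R d^s)^{NM}` (from `‖Res_N χ‖² ≤ [G:N]`), volume
`(M!)^3 L^M`, and the multinomial/`N → ∞` amplification of CKSU Thm 7.1/5.5.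
[cite: CohnKleinbergSzegedyUmans2005, Thm. 7.1] -/
theorem gradedWreathLink : GradedSimultaneousFamily → GradedDesignFamily := by
  sorry

/-- The trivial direction (`t = 1`): so `GradedSimultaneousFamily ↔ GradedDesignFamily` once the
link is proved — the transfer is to an EQUIVALENT statement with more witnesses. [folklore] -/
theorem family_of_single : GradedDesignFamily → GradedSimultaneousFamily := by
  intro h ε hε
  obtain ⟨G, hG, hF, J, X, Y, Z, hJ, hsep, hlt⟩ := h ε hε
  refine ⟨G, hG, hF, J, 1, (fun _ => X), (fun _ => Y), (fun _ => Z), hJ, ?_, ?_⟩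
  · intro i x₀ hx₀ z₀ hz₀
    obtain ⟨f, hf, hfsep⟩ := hsep x₀ hx₀ z₀ hz₀
    refine ⟨f, hf, ?_⟩
    intro a b x hx y hy y' hy' z hz
    have ha : a = i := Subsingleton.elim a i
    have hb : b = i := Subsingleton.elim b i
    obtain ⟨h1, h0⟩ := hfsep x hx y hy y' hy' z hz
    refine ⟨fun hh => h1 ⟨hh.2.2.1, hh.2.2.2.1, hh.2.2.2.2⟩, fun hh => h0 ?_⟩
    rintro ⟨hx', hy'', hz'⟩
    exact hh ⟨ha, hb, hx', hy'', hz'⟩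
  · simpa [gradedBudget] using hlt

/-! ## By-products of the withdrawn card `grade-the-champions` (see negative-champions-ungradable.md) -/

/-- FIRST LEMMA of the card: the general-`G` subgroup identity test (lever L1 of the route, there
only for `GL_m(𝔽_p)`/`F_k`): for a bi-invariant `J` and a subgroup-TPP triple, ONE `f ∈ J` with
`f 1 = 1` and `f = 0` on `H₁H₂H₃ ∖ {1}` separates the triple of carriers (translate `f` by
`g ↦ f (x₀ g z₀⁻¹)`). [cite: BlasiakCohnGrochowPrattUmans2024, Def. 2.1] -/
theorem subgroup_identity_separated {G : Type} [Group G] [Fintype G] [DecidableEq G]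
    (J : Submodule ℂ (G → ℂ)) (hJ : BiInvariant J) (H₁ H₂ H₃ : Subgroup G)
    [DecidablePred (· ∈ H₁)] [DecidablePred (· ∈ H₂)] [DecidablePred (· ∈ H₃)]
    (hT : Literature.Barriers.MatrixMultiplication.SubgroupTPP H₁ H₂ H₃)
    (f : G → ℂ) (hf : f ∈ J) (h1 : f 1 = 1)
    (h0 : ∀ a ∈ H₁, ∀ b ∈ H₂, ∀ c ∈ H₃, a * b * c ≠ 1 → f (a * b * c) = 0) :
    Separated (J : Set (G → ℂ)) (Finset.univ.filter (· ∈ H₁)) (Finset.univ.filter (· ∈ H₂))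
      (Finset.univ.filter (· ∈ H₃)) := by
  intro x₀ hx₀ z₀ hz₀
  simp only [Finset.mem_filter, Finset.mem_univ, true_and] at hx₀ hz₀
  refine ⟨fun g => f (x₀ * g * z₀⁻¹), hJ f hf x₀ z₀⁻¹, ?_⟩
  intro x hx y hy y' hy' z hz
  simp only [Finset.mem_filter, Finset.mem_univ, true_and] at hx hy hy' hz
  have key : x₀ * (x⁻¹ * y * y'⁻¹ * z) * z₀⁻¹ = (x₀ * x⁻¹) * (y * y'⁻¹) * (z * z₀⁻¹) := by group
  have ha : x₀ * x⁻¹ ∈ H₁ := H₁.mul_mem hx₀ (H₁.inv_mem hx)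
  have hb : y * y'⁻¹ ∈ H₂ := H₂.mul_mem hy (H₂.inv_mem hy')
  have hc : z * z₀⁻¹ ∈ H₃ := H₃.mul_mem hz (H₃.inv_mem hz₀)
  refine ⟨?_, ?_⟩
  · rintro ⟨rfl, rfl, rfl⟩
    show f (x * (x⁻¹ * y * y⁻¹ * z) * z⁻¹) = 1
    have : x * (x⁻¹ * y * y⁻¹ * z) * z⁻¹ = 1 := by group
    rw [this, h1]
  · intro hne
    show f (x₀ * (x⁻¹ * y * y'⁻¹ * z) * z₀⁻¹) = 0
    rw [key]
    apply h0 _ ha _ hb _ hc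
    intro habc
    obtain ⟨h₁, h₂, h₃⟩ := hT _ ha _ hb _ hc habc
    apply hne
    refine ⟨?_, ?_, ?_⟩
    · exact (mul_inv_eq_one.mp h₁).symm
    · exact mul_inv_eq_one.mp h₂
    · exact mul_inv_eq_one.mp h₃

/-- The **dimension-cutoff test space** `J_T`: span of the two-sided translates of the irreducible
characters of degree `≤ T` (`= ⊕_{χ(1) ≤ T} M_χ`, bi-invariant by construction). The budget-optimal
grading of a FIXED triple is such a cutoff up to the identity test, and `T < V^{1/3}` is forced by
`d_max^{2+ε} ≤ budget < V^{(2+ε)/3}`. [folklore] -/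
def dimCutoff (G : Type) [Group G] [Fintype G] (T : ℝ) : Submodule ℂ (G → ℂ) :=
  Submodule.span ℂ {f | ∃ χ ∈ irrChars G, (χ 1).re ≤ T ∧ ∃ a b : G, f = fun g => χ (a * g * b)}

/-- The triangular array of Cohn–Umans 2003, Thm. 6: points `(a,b,c)` with `a + b + c = n − 1`.
[cite: CohnUmans2003, Thm. 6] -/
def TriPts (n : ℕ) : Type := {p : Fin n × Fin n × Fin n // (p.1 : ℕ) + p.2.1 + p.2.2 = n - 1}

instance (n : ℕ) : Fintype (TriPts n) := by unfold TriPts; infer_instance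
instance (n : ℕ) : DecidableEq (TriPts n) := by unfold TriPts; infer_instance

/-- The `i`-th coordinate of a point of the triangular array. [cite: CohnUmans2003, Thm. 6] -/
def triCoord (n : ℕ) (i : Fin 3) (p : TriPts n) : ℕ :=
  if i = 0 then (p.1.1 : ℕ) else if i = 1 then (p.1.2.1 : ℕ) else (p.1.2.2 : ℕ)

/-- The three Young subgroups of the triangle champion: permutations preserving the `i`-th
coordinate (lines parallel to one side), of order `1!2!⋯n!`; they satisfy the subgroup TPP and
`|H| = |S_N|^{1/2} e^{-Θ(N)}`, `N = n(n+1)/2` (CU2003 Thm. 6; BCCGU2017 Thm. 4.1).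
[cite: CohnUmans2003, Thm. 6] -/
def triYoung (n : ℕ) (i : Fin 3) : Subgroup (Equiv.Perm (TriPts n)) where
  carrier := {σ | ∀ p, triCoord n i (σ p) = triCoord n i p}
  mul_mem' := by
    intro σ τ hσ hτ p
    simp only [Set.mem_setOf_eq] at hσ hτ ⊢
    rw [Equiv.Perm.mul_apply, hσ, hτ]
  one_mem' := by
    intro p
    simp
  inv_mem' := by
    intro σ hσ p
    simp only [Set.mem_setOf_eq] at hσ ⊢
    conv_rhs => rw [← Equiv.apply_symm_apply σ p]
    exact (hσ (σ.symm p)).symm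

/-- **The graded triangle conjecture** (finite, one linear test per `(n, J)`): for every `ε > 0` some
triangle champion passes the identity test for a bi-invariant `J` whose graded budget at `2 + ε` is
below `(|H₁||H₂||H₃|)^{(2+ε)/3}`. The experiment of the card runs `J = dimCutoff` and greedy
sub-spectra at `n = 3`. [cite: CohnUmans2003, Thm. 6] -/
def TriangleGradable : Prop :=
  ∀ ε : ℝ, 0 < ε → ∃ (n : ℕ) (J : Submodule ℂ (Equiv.Perm (TriPts n) → ℂ)),
    BiInvariant J ∧
    (∃ f ∈ J, f 1 = 1 ∧ ∀ a ∈ triYoung n 0, ∀ b ∈ triYoung n 1, ∀ c ∈ triYoung n 2,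
        a * b * c ≠ 1 → f (a * b * c) = 0) ∧
    gradedBudget (Equiv.Perm (TriPts n)) J (2 + ε) <
      ((Nat.card (triYoung n 0) * Nat.card (triYoung n 1) * Nat.card (triYoung n 2) : ℕ) : ℝ) ^
        ((2 + ε) / 3)

/-- The graded triangle conjecture decides the crux (via `subgroup_identity_separated` and the
subgroup TPP of the triangle, CU2003 Thm. 6). [cite: CohnUmans2003, Thm. 6] -/
theorem triangleGradable_imp : TriangleGradable → GradedDesignFamily := by
  sorry

/-! ## Card `schur-weyl-colour-cells`: the transversal grading of `S_n` -/

/-- The **`r`-colour test space** of `S_n`: span of the colouring-incidence tests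
`g ↦ [c' ∘ g = c]` for `c, c' : Fin n → Fin r` — the coefficient space of the Schur–Weyl module
`(ℂ^r)^{⊗n}`; bi-invariant; its irreducible constituents are the `χ_λ` with at most `r` rows.
[cite: BlasiakChurchCohnGrochowUmans2017, §5] -/
def colourSpace (n r : ℕ) : Submodule ℂ (Equiv.Perm (Fin n) → ℂ) :=
  Submodule.span ℂ {f | ∃ c c' : Fin n → Fin r,
    f = fun g : Equiv.Perm (Fin n) => if c' ∘ (g : Fin n → Fin n) = c then (1 : ℂ) else 0}

/-- **Colour budget** (Schur–Weyl duality in the direction the pricing needs): every irreducible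
character of `S_n` inside `colourSpace n r` is `χ_μ` with at most `r` parts, so
`Σᶠ_{χ ∈ Irr ∩ colourSpace} χ(1)^s ≤ Σ_{μ ⊢ n, ℓ(μ) ≤ r} f_μ^s`. [cite: EllisFriedgutPilpel2011, Thm. 7] -/
def ColourBudget : Prop :=
  ∀ (n r : ℕ) (s : ℝ), 0 ≤ s →
    (∑ᶠ χ ∈ irrChars (Equiv.Perm (Fin n)) ∩ (colourSpace n r : Set (Equiv.Perm (Fin n) → ℂ)),
        (χ 1).re ^ s) ≤
      ∑ μ : Nat.Partition n, if μ.parts.card ≤ r then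
        (Literature.NumberTheory.DiophantineGeometry.numStandardTableaux μ : ℝ) ^ s else 0

/-- **Colour designs** (the third engine): for every `ε > 0` some `n, r` and a colour-`r`-separated
triple in `S_n` beating `Σ_{ℓ(μ) ≤ r} f_μ^{2+ε}`. [cite: BlasiakChurchCohnGrochowUmans2017, §5] -/
def ColourDesigns : Prop :=
  ∀ ε : ℝ, 0 < ε → ∃ (n r : ℕ) (X Y Z : Finset (Equiv.Perm (Fin n))),
    Separated (colourSpace n r : Set (Equiv.Perm (Fin n) → ℂ)) X Y Z ∧
    (∑ μ : Nat.Partition n, if μ.parts.card ≤ r then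
        (Literature.NumberTheory.DiophantineGeometry.numStandardTableaux μ : ℝ) ^ (2 + ε) else 0) <
      ((X.card * Y.card * Z.card : ℕ) : ℝ) ^ ((2 + ε) / 3)

/-- The two-sided translation operator `f ↦ (g ↦ f (a g b))` as a linear map. [folklore] -/
def biTranslate {G : Type} [Group G] (a b : G) : (G → ℂ) →ₗ[ℂ] (G → ℂ) where
  toFun f := fun g => f (a * g * b)
  map_add' f₁ f₂ := by ext g; simp
  map_smul' c f := by ext g; simp

/-- `colourSpace n r` is bi-invariant: a two-sided translate of a colouring-incidence test is again
one (`[c' ∘ (a g b) = c] = [(c' ∘ a) ∘ g = c ∘ b⁻¹]`). [folklore] -/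
theorem colourSpace_biInvariant (n r : ℕ) : BiInvariant (colourSpace n r) := by
  intro f hf a b
  have hgen : ∀ f ∈ {f | ∃ c c' : Fin n → Fin r,
      f = fun g : Equiv.Perm (Fin n) => if c' ∘ (g : Fin n → Fin n) = c then (1 : ℂ) else 0},
      biTranslate a b f ∈ colourSpace n r := by
    rintro f ⟨c, c', rfl⟩
    apply Submodule.subset_span
    refine ⟨c ∘ (b⁻¹ : Equiv.Perm (Fin n)), c' ∘ (a : Fin n → Fin n), ?_⟩
    ext g
    simp only [biTranslate, LinearMap.coe_mk, AddHom.coe_mk]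
    have key : (c' ∘ ⇑(a * g * b) = c) ↔ ((c' ∘ ⇑a) ∘ ⇑g = c ∘ ⇑(b⁻¹ : Equiv.Perm (Fin n))) := by
      constructor
      · intro h
        funext i
        have := congrFun h (b⁻¹ i)
        simp only [Function.comp_apply, Equiv.Perm.coe_mul] at this ⊢
        simpa using this
      · intro h
        funext i
        have := congrFun h (b i)
        simp only [Function.comp_apply, Equiv.Perm.coe_mul] at this ⊢
        simpa using this
    by_cases h : c' ∘ ⇑(a * g * b) = c
    · rw [if_pos h, if_pos (key.mp h)]
    · rw [if_neg h, if_neg (fun h' => h (key.mpr h'))]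
  have hmap : Submodule.map (biTranslate a b) (colourSpace n r) ≤ colourSpace n r := by
    unfold colourSpace
    rw [Submodule.map_span]
    apply Submodule.span_le.mpr
    rintro _ ⟨f, hfS, rfl⟩
    exact hgen f hfS
  exact hmap (Submodule.mem_map_of_mem hf)

/-- FIRST LEMMA of the card, PROVED modulo the Schur–Weyl budget fact `ColourBudget`: the colour engine
is load-bearing. [folklore] -/
theorem colourLink : ColourBudget → ColourDesigns → GradedDesignFamily := by
  intro hB hD ε hε
  obtain ⟨n, r, X, Y, Z, hsep, hlt⟩ := hD ε hε
  refine ⟨Equiv.Perm (Fin n), inferInstance, inferInstance, colourSpace n r, X, Y, Z,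
    colourSpace_biInvariant n r, hsep, ?_⟩
  have hb := hB n r (2 + ε) (by linarith)
  exact lt_of_le_of_lt hb hlt

/-- The wall of the colour cell, `D_r(n) = Σ_{ℓ(μ) ≤ r} f_μ²` (`= #{π : lds(π) ≤ r}` by RSK).
[cite: RaghavanSamuelSubrahmanyam2009, Thm. 2] -/
def colourWall (n r : ℕ) : ℕ :=
  ∑ μ : Nat.Partition n, if μ.parts.card ≤ r then
    Literature.NumberTheory.DiophantineGeometry.numStandardTableaux μ ^ 2 else 0

/-- **Fixed-cell universality** of the colour engine (the structural advantage over token levels):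
at FIXED `r ≥ 2`, `N_eff = D_r / max f_μ² ≍ n^{(r-1)/2} → ∞`, so wall saturation up to ANY fixed
constant `c` along infinitely many `n` already gives `ColourDesigns` (all `ε`). -/
def ColourUniversality : Prop :=
  ∀ r : ℕ, 2 ≤ r → ∀ c : ℝ, 0 < c →
    (∀ n₀ : ℕ, ∃ n, n₀ ≤ n ∧ ∃ X Y Z : Finset (Equiv.Perm (Fin n)),
        Separated (colourSpace n r : Set (Equiv.Perm (Fin n) → ℂ)) X Y Z ∧
        c * (colourWall n r : ℝ) ^ (3 / 2 : ℝ) ≤ ((X.card * Y.card * Z.card : ℕ) : ℝ)) →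
    ColourDesigns

end

end Summit.MatrixMultiplication.MatrixMultiplication.Cruxes.GradedDesignFamily.Ideator1
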